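import Mathlib
import Literature.NumberTheory.Automorphic.L2EigenvalueNonneg
import Literature.NumberTheory.Automorphic.CuspFormsCompact
import Literature.Analysis.Complex.SquareIntegrableHolomorphicFamily

/-!
# The Selberg transform off the real axis: `ĥ_k(s)`, positivity on strips, bump kernels, holomorphic parametric integrals
(Iwaniec, *Spectral Methods of Automorphic Forms*, GSM 53, §1.8 (1.62) & Theorem 1.16, PDF p. 24;
§7.2 (the small-disc kernels of the proof of Prop. 7.2), PDF p. 73)

Analytic support for the meromorphic continuation of the Eisenstein series of a general finite
volume group (`FuchsianEisensteinTails`, `FuchsianEisensteinContinuation*`, towards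
`Iwaniec2002_eq_12_5` / `Iwaniec2002_thm_12_1`). The continuation is run through the resolvents of the
compact operators `P_Y T_k P_Y` (`FuchsianPseudoCuspForms`) at the spectral value `ĥ_k(s)`, the
eigenvalue of `T_k` on `𝒜_s`; this file isolates what is needed about `s ↦ ĥ_k(s)` and about the
kernels `k`. Everything is PROVED; no fact is introduced.

0. (§0) **holomorphic parametric integrals** (`differentiableOn_integral_mul_of_bound`): for an
   integrable weight `φ` and a family `G(s, x)` holomorphic in `s ∈ U` pointwise, measurable in `x`
   and uniformly bounded, `s ↦ ∫ φ(x) G(s, x) dμ` is holomorphic on `U` (differentiation under the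
   integral sign with the uniform Cauchy estimate of `SquareIntegrableHolomorphicFamily`;
   `aestronglyMeasurable_deriv_family`).
1. (§1) `eigenvalueFn k s = ĥ_k(s) := h_k(-i(s - 1/2))` (`s = 1/2 + it`): entire
   (`differentiable_eigenvalueFn`), `T_k (Im g·)^s = ĥ_k(s)(Im g·)^s` for all `s ∈ ℂ`, `g ∈ SL₂(ℝ)`
   (Theorem 1.16; `invariantOperator_im_smul_cpow_eq`); the real part
   `Re h(a + ib) = ∫ cosh(br) cos(ar) g(r) dr` (`selbergTransform_re_eq`) and its POSITIVITY for a
   non-negative kernel of support radius `R` when `R|a| < π/2` (`selbergTransform_re_pos`), whence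
   **`Re ĥ_k(s) > 0`, in particular `ĥ_k(s) ≠ 0`, on the horizontal strip `R |Im s| < π/2`**
   (`eigenvalueFn_re_pos`, `eigenvalueFn_ne_zero`); and **`Im ĥ_k(s) ≠ 0` off `Im s = 0`, `Re s = 1/2`**
   (`eigenvalueFn_im_ne_zero`, from `selbergTransform_im_ne_zero`): there `ĥ_k(s)` is non-real, so
   no `L²` eigenfunction of the self-adjoint `T_k` has eigenvalue `ĥ_k(s)`.
2. (§2) **bump kernels** `bumpKernel M` (`ContDiffBump`): smooth, `0 ≤ k ≤ 1`, `= 1` on `u ≤ M/2`,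
   `= 0` on `u ≥ M`, a Lipschitz test kernel of positive mass; `kernelRadius_le_of_le`; the supports
   `stripSupport N` with `R_{M_N}(N + 1) ≤ 1/2` (`stripSupport_small`), giving one admissible kernel
   for each strip `|Im s| < N + 1`.

## References
* [Iwaniec2002] H. Iwaniec, *Spectral Methods of Automorphic Forms*, 2nd ed., GSM 53, AMS 2002,
  (1.62) & Thm 1.16, PDF p. 24; §7.2, PDF p. 73 (held copy `book:iwaniec2002-spectral-methods-automorphic-forms`).

Mathlib: `hasDerivAt_integral_of_dominated_loc_of_deriv_le`, `aestronglyMeasurable_of_tendsto_ae`,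
`HasDerivAt.tendsto_slope_zero`, `ContDiffBump`, `ContDiff.lipschitzWith_of_hasCompactSupport`,
`Real.arsinh_le_arsinh`, `Real.sqrt_le_left`. Literature: `selbergTransform`, `selbergG`, `IsTestKernel`,
`differentiable_selbergTransform`, `selbergTransform_neg` (`SelbergTransform`); `invariantOperator_im_smul_cpow`
(`InvariantIntegralOperators`); `selbergTransform_im_ne_zero`, `I_mul_ofReal_mul_add_mul_I`,
`abs_lt_of_selbergG_ne_zero`, `integral_eq_zero_of_selbergG_ae_eq_zero`, `integrable_mul_selbergG(_complex)`
(`L2EigenvalueNonneg`, `SelbergTransform`); `selbergG_nonneg` (`EisensteinOrthogonality`); `kernelRadius`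
(`CuspFormsCompact`); `norm_deriv_le_of_bound` (`Analysis/Complex/SquareIntegrableHolomorphicFamily`).
-/

noncomputable section

namespace Literature.NumberTheory.Automorphic

open MeasureTheory Set Filter Real _root_.Topology Metric UpperHalfPlane
open scoped ENNReal NNReal MatrixGroups

/-! ## 0. Holomorphic parametric integrals of bounded holomorphic families -/

section Parametric

variable {X : Type*} [MeasurableSpace X] {μ : Measure X}

/-- **The derivative of a measurable holomorphic family is measurable** (pointwise limit of difference
quotients). [folklore] -/
theorem aestronglyMeasurable_deriv_family {G : ℂ → X → ℂ} {U : Set ℂ} (hU : IsOpen U)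
    (hdiff : ∀ x, DifferentiableOn ℂ (fun s => G s x) U) (hmeas : ∀ s ∈ U, AEStronglyMeasurable (G s) μ)
    {s₀ : ℂ} (hs₀ : s₀ ∈ U) : AEStronglyMeasurable (fun x => deriv (fun s => G s x) s₀) μ := by
  obtain ⟨ρ, hρ, hρU⟩ := Metric.isOpen_iff.mp hU s₀ hs₀
  set tseq : ℕ → ℝ := fun n => (ρ / 2) / ((n : ℝ) + 1) with htseq
  have htpos : ∀ n, 0 < tseq n := fun n => by rw [htseq]; positivity
  have htle : ∀ n, tseq n ≤ ρ / 2 := fun n => by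
    rw [htseq]
    exact div_le_self (by linarith) (by linarith [(Nat.cast_nonneg n : (0 : ℝ) ≤ n)])
  have htend : Tendsto tseq atTop (𝓝 0) := by
    rw [htseq]
    exact tendsto_const_nhds.div_atTop (tendsto_natCast_atTop_atTop.atTop_add tendsto_const_nhds)
  have htend' : Tendsto (fun n => ((tseq n : ℝ) : ℂ)) atTop (𝓝[≠] 0) := by
    rw [tendsto_nhdsWithin_iff]
    refine ⟨?_, Eventually.of_forall fun n => ?_⟩
    · have := (Complex.continuous_ofReal.tendsto 0).comp htend
      rw [Complex.ofReal_zero] at this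
      exact this
    · simp only [mem_compl_iff, mem_singleton_iff, Complex.ofReal_eq_zero]
      exact (htpos n).ne'
  have hmemU : ∀ n, s₀ + ((tseq n : ℝ) : ℂ) ∈ U := fun n => hρU (by
    rw [mem_ball, dist_eq_norm, add_sub_cancel_left, Complex.norm_real, Real.norm_of_nonneg (htpos n).le]
    linarith [htle n])
  set q : ℕ → X → ℂ := fun n x => ((tseq n : ℝ) : ℂ)⁻¹ • (G (s₀ + (tseq n : ℂ)) x - G s₀ x) with hq
  have hqm : ∀ n, AEStronglyMeasurable (q n) μ := by
    intro n
    have := ((hmeas _ (hmemU n)).sub (hmeas s₀ hs₀)).const_smul ((((tseq n : ℝ) : ℂ))⁻¹)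
    exact this
  have hqlim : ∀ᵐ x ∂μ, Tendsto (fun n => q n x) atTop (𝓝 (deriv (fun s => G s x) s₀)) := by
    refine Eventually.of_forall fun x => ?_
    have hdx : HasDerivAt (fun s => G s x) (deriv (fun s => G s x) s₀) s₀ :=
      ((hdiff x s₀ hs₀).differentiableAt (hU.mem_nhds hs₀)).hasDerivAt
    exact hdx.tendsto_slope_zero.comp htend'
  exact aestronglyMeasurable_of_tendsto_ae atTop hqm hqlim

/-- **Holomorphy of parametric integrals of bounded holomorphic families**: if `φ` is integrable,
each `s ↦ G(s, x)` is holomorphic on the open `U`, each `G(s, ·)` is a.e.-strongly measurable and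
`|G| ≤ C` on `U × X`, then `s ↦ ∫ φ(x) G(s, x) dμ(x)` is holomorphic on `U` (differentiation under the
integral sign, the derivative in `s` being bounded by the uniform Cauchy estimate). [folklore] -/
theorem differentiableOn_integral_mul_of_bound {φ : X → ℂ} (hφ : Integrable φ μ) {G : ℂ → X → ℂ}
    {U : Set ℂ} (hU : IsOpen U) (hdiff : ∀ x, DifferentiableOn ℂ (fun s => G s x) U)
    (hmeas : ∀ s ∈ U, AEStronglyMeasurable (G s) μ) {C : ℝ} (hC : ∀ s ∈ U, ∀ x, ‖G s x‖ ≤ C) :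
    DifferentiableOn ℂ (fun s => ∫ x, φ x * G s x ∂μ) U := by
  intro s₀ hs₀
  obtain ⟨ρ, hρ, hρU⟩ := Metric.isOpen_iff.mp hU s₀ hs₀
  set r : ℝ := ρ / 4 with hr
  have hr0 : 0 < r := by rw [hr]; positivity
  have hsub : closedBall s₀ (2 * r) ⊆ U := by
    refine Subset.trans ?_ hρU
    intro z hz
    rw [mem_closedBall] at hz
    rw [mem_ball]
    linarith
  have hballU : ball s₀ r ⊆ U := Subset.trans ball_subset_closedBall
    (Subset.trans (closedBall_subset_closedBall (by linarith)) hsub)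
  -- derivative bound on `ball s₀ r`
  have hderiv : ∀ s ∈ ball s₀ r, ∀ x, ‖deriv (fun s => G s x) s‖ ≤ C / r := by
    intro s hs x
    refine Literature.Analysis.Complex.norm_deriv_le_of_bound (hdiff x) (fun z hz => hC z hz x) hr0 (Subset.trans ?_ hsub)
    intro z hz
    rw [mem_closedBall] at hz ⊢
    rw [mem_ball] at hs
    linarith [dist_triangle z s s₀]
  have key := hasDerivAt_integral_of_dominated_loc_of_deriv_le (μ := μ) (x₀ := s₀) (s := ball s₀ r)
    (F := fun s x => φ x * G s x) (F' := fun s x => φ x * deriv (fun s => G s x) s)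
    (bound := fun x => ‖φ x‖ * (C / r)) (ball_mem_nhds s₀ hr0) ?_ ?_ ?_ ?_ ?_ ?_
  · exact key.2.differentiableAt.differentiableWithinAt
  · filter_upwards [hU.mem_nhds hs₀] with s hs
    exact hφ.aestronglyMeasurable.mul (hmeas s hs)
  · have h1 : Integrable (fun x => G s₀ x * φ x) μ :=
      hφ.bdd_mul (hmeas s₀ hs₀) (Eventually.of_forall fun x => hC s₀ hs₀ x)
    exact h1.congr (Eventually.of_forall fun x => mul_comm _ _)
  · exact hφ.aestronglyMeasurable.mul (aestronglyMeasurable_deriv_family hU hdiff hmeas hs₀)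
  · refine Eventually.of_forall fun x s hs => ?_
    rw [norm_mul]
    exact mul_le_mul_of_nonneg_left (hderiv s hs x) (norm_nonneg _)
  · exact hφ.norm.mul_const _
  · refine Eventually.of_forall fun x s hs => ?_
    exact (((hdiff x s (hballU hs)).differentiableAt (hU.mem_nhds (hballU hs))).hasDerivAt).const_mul (φ x)

end Parametric

/-! ## 1. The eigenvalue `ĥ(s) = h(-i(s - 1/2))` of the invariant integral operators on `y^s` -/

section Eigenvalue

variable {k : ℝ → ℝ}

/-- **The eigenvalue of `T_k` on `𝒜_s`**: `ĥ_k(s) = h_k(t)` with `s = 1/2 + it`, i.e.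
`t = -i(s - 1/2)`; `T_k y^s = ĥ_k(s) y^s` (Theorem 1.16). [cite: Iwaniec2002, Thm 1.16 & (1.62), PDF p. 24] -/
def eigenvalueFn (k : ℝ → ℝ) (s : ℂ) : ℂ := selbergTransform k (-Complex.I * (s - 1 / 2))

/-- `1/2 + i(-i(s - 1/2)) = s` (a private copy of `half_add_I_mul` of `ModularEisensteinSeries`,
which is not in the import closure). [folklore] -/
private theorem half_add_I_mul_specParam (s : ℂ) : (1 / 2 : ℂ) + Complex.I * (-Complex.I * (s - 1 / 2)) = s := by
  have hI : Complex.I * Complex.I = -1 := Complex.I_mul_I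
  linear_combination (-(s - 1 / 2)) * hI

/-- The spectral parameter in real coordinates: `-i(s - 1/2) = Im s + (1/2 - Re s) i`. [folklore] -/
theorem specParam_eq (s : ℂ) :
    -Complex.I * (s - 1 / 2) = ((s.im : ℝ) : ℂ) + ((1 / 2 - s.re : ℝ) : ℂ) * Complex.I := by
  apply Complex.ext
  · simp
  · simp

/-- **`ĥ_k` is entire.** [cite: Iwaniec2002, (1.62), PDF p. 24] -/
theorem differentiable_eigenvalueFn (hk : IsTestKernel k) : Differentiable ℂ (eigenvalueFn k) := by
  unfold eigenvalueFn
  exact (differentiable_selbergTransform hk).comp ((differentiable_id.sub_const _).const_mul _)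

/-- `ĥ_k` is analytic everywhere. [folklore] -/
theorem analyticAt_eigenvalueFn (hk : IsTestKernel k) (s : ℂ) : AnalyticAt ℂ (eigenvalueFn k) s :=
  (differentiable_eigenvalueFn hk).analyticAt s

/-- `ĥ_k` is continuous. [folklore] -/
theorem continuous_eigenvalueFn (hk : IsTestKernel k) : Continuous (eigenvalueFn k) :=
  (differentiable_eigenvalueFn hk).continuous

/-- **Theorem 1.16 on `(Im g·)^s`**: `T_k (Im g·)^s = ĥ_k(s) (Im g·)^s` for `g ∈ SL₂(ℝ)`, all `s ∈ ℂ`.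
[cite: Iwaniec2002, Thm 1.16, PDF p. 24] -/
theorem invariantOperator_im_smul_cpow_eq (hk : IsTestKernel k) (g : SL(2, ℝ)) (s : ℂ) (z : ℍ) :
    invariantOperator k (fun w : ℍ => (((g • w).im : ℝ) : ℂ) ^ s) z = eigenvalueFn k s * (((g • z).im : ℝ) : ℂ) ^ s := by
  have h := invariantOperator_im_smul_cpow hk g (-Complex.I * (s - 1 / 2)) z
  rw [half_add_I_mul_specParam] at h
  exact h

/-- … and on `(Im ·)^s`. [cite: Iwaniec2002, Thm 1.16, PDF p. 24] -/
theorem invariantOperator_im_cpow_eq (hk : IsTestKernel k) (s : ℂ) (z : ℍ) :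
    invariantOperator k (fun w : ℍ => ((w.im : ℝ) : ℂ) ^ s) z = eigenvalueFn k s * ((z.im : ℝ) : ℂ) ^ s := by
  have h := invariantOperator_im_smul_cpow_eq hk 1 s z
  simp only [one_smul] at h
  exact h

/-- **The real part of `h(a + ib)`**: `Re h(a + ib) = ∫ cosh(br) cos(ar) g(r) dr` (`g` even). [folklore] -/
theorem selbergTransform_re_eq {B M : ℝ} (hkm : Measurable k) (hB : ∀ u, |k u| ≤ B)
    (hM : ∀ u, M ≤ u → k u = 0) (hM0 : 0 ≤ M) (a b : ℝ) :
    (selbergTransform k ((a : ℂ) + b * Complex.I)).re =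
      ∫ r, Real.cosh (b * r) * Real.cos (a * r) * selbergG k r := by
  unfold selbergTransform
  have hint := integrable_mul_selbergG_complex hkm hB hM hM0
    (φ := fun r : ℝ => Complex.exp (Complex.I * r * ((a : ℂ) + b * Complex.I))) (by fun_prop)
  have h := integral_re hint
  simp only [RCLike.re_to_complex] at h
  rw [← h]
  set G : ℝ → ℝ := fun r => Real.exp (-(b * r)) * Real.cos (a * r) * selbergG k r with hG
  have hGeq : ∀ r : ℝ, (Complex.exp (Complex.I * r * ((a : ℂ) + b * Complex.I)) * (selbergG k r : ℂ)).re = G r := by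
    intro r
    have hre : (((-(b * r) : ℝ) : ℂ) + ((a * r : ℝ) : ℂ) * Complex.I).re = -(b * r) := by simp
    have him : (((-(b * r) : ℝ) : ℂ) + ((a * r : ℝ) : ℂ) * Complex.I).im = a * r := by simp
    rw [I_mul_ofReal_mul_add_mul_I, Complex.re_mul_ofReal, Complex.exp_re, hre, him]
  simp_rw [hGeq]
  have hGi : Integrable G :=
    integrable_mul_selbergG hkm hB hM hM0 (φ := fun r => Real.exp (-(b * r)) * Real.cos (a * r)) (by fun_prop)
  have hGn : ∫ r, G (-r) = ∫ r, G r := integral_neg_eq_self G volume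
  have h2 : 2 * ∫ r, G r = ∫ r, (G r + G (-r)) := by
    rw [integral_add hGi hGi.comp_neg, hGn]; ring
  have h3 : ∀ r, G r + G (-r) = 2 * (Real.cosh (b * r) * Real.cos (a * r) * selbergG k r) := by
    intro r
    simp only [hG, selbergG_neg, mul_neg, neg_neg, Real.cos_neg]
    rw [Real.cosh_eq, Real.exp_neg]
    ring
  simp_rw [h3] at h2
  rw [integral_const_mul] at h2
  linarith

/-- **`Re h(a + ib) > 0` for a non-negative kernel of small support**: if `k ≥ 0` is a test kernel
with `∫₀^∞ k > 0`, vanishing on `[M, ∞)`, and `2 arsinh(√M) |a| < π/2`, then `Re h(a + ib) > 0`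
(the integrand `cosh(br) cos(ar) g(r)` is non-negative and `g` is not a.e. zero). [folklore] -/
theorem selbergTransform_re_pos {M : ℝ} (hk : IsTestKernel k) (hk0 : ∀ u, 0 ≤ k u)
    (hkpos : 0 < ∫ u in Ioi 0, k u) (hM : ∀ u, M ≤ u → k u = 0) (hM0 : 0 ≤ M)
    {a : ℝ} (hsmall : 2 * Real.arsinh (Real.sqrt M) * |a| < π / 2) (b : ℝ) :
    0 < (selbergTransform k ((a : ℂ) + b * Complex.I)).re := by
  obtain ⟨hkm, ⟨B, hB⟩, -⟩ := id hk
  rw [selbergTransform_re_eq hkm hB hM hM0]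
  set P : ℝ → ℝ := fun r => Real.cosh (b * r) * Real.cos (a * r) * selbergG k r with hP
  have hPi : Integrable P :=
    integrable_mul_selbergG hkm hB hM hM0 (φ := fun r => Real.cosh (b * r) * Real.cos (a * r)) (by fun_prop)
  have hcos : ∀ r, selbergG k r ≠ 0 → 0 < Real.cos (a * r) := by
    intro r hr
    have h1 := abs_lt_of_selbergG_ne_zero hM hM0 hr
    apply Real.cos_pos_of_mem_Ioo
    have h2 : |a * r| < π / 2 := by
      rw [abs_mul]
      calc |a| * |r| ≤ |a| * (2 * Real.arsinh (Real.sqrt M)) := mul_le_mul_of_nonneg_left h1.le (abs_nonneg a)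
        _ = 2 * Real.arsinh (Real.sqrt M) * |a| := by ring
        _ < π / 2 := hsmall
    constructor <;> linarith [abs_lt.mp h2 |>.1, abs_lt.mp h2 |>.2]
  have hP0 : 0 ≤ P := by
    intro r
    simp only [hP, Pi.zero_apply]
    by_cases hg : selbergG k r = 0
    · simp [hg]
    · exact mul_nonneg (mul_nonneg (Real.cosh_pos _).le (hcos r hg).le) (selbergG_nonneg hk0 r)
  have hint0 : 0 ≤ ∫ r, P r := integral_nonneg hP0
  rcases hint0.lt_or_eq with hlt | heq
  · exact hlt
  · exfalso
    have hPae : P =ᵐ[volume] 0 := (integral_eq_zero_iff_of_nonneg hP0 hPi).mp heq.symm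
    have hg : selbergG k =ᵐ[volume] 0 := by
      filter_upwards [hPae] with r hr
      simp only [hP, Pi.zero_apply, mul_eq_zero] at hr
      simp only [Pi.zero_apply]
      by_contra hg
      rcases hr with (h | h) | h
      · exact (Real.cosh_pos _).ne' h
      · exact (hcos r hg).ne' h
      · exact hg h
    have := integral_eq_zero_of_selbergG_ae_eq_zero hk hg
    linarith

/-- **`Re ĥ_k(s) > 0` on the horizontal strip `2 arsinh(√M) |Im s| < π/2`** for a non-negative test
kernel supported in `u ≤ M` with positive mass — in particular `ĥ_k(s) ≠ 0` there. [folklore] -/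
theorem eigenvalueFn_re_pos {M : ℝ} (hk : IsTestKernel k) (hk0 : ∀ u, 0 ≤ k u)
    (hkpos : 0 < ∫ u in Ioi 0, k u) (hM : ∀ u, M ≤ u → k u = 0) (hM0 : 0 ≤ M)
    {s : ℂ} (hsmall : 2 * Real.arsinh (Real.sqrt M) * |s.im| < π / 2) : 0 < (eigenvalueFn k s).re := by
  unfold eigenvalueFn
  rw [specParam_eq]
  exact selbergTransform_re_pos hk hk0 hkpos hM hM0 hsmall _

/-- `ĥ_k(s) ≠ 0` on that strip. [folklore] -/
theorem eigenvalueFn_ne_zero {M : ℝ} (hk : IsTestKernel k) (hk0 : ∀ u, 0 ≤ k u)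
    (hkpos : 0 < ∫ u in Ioi 0, k u) (hM : ∀ u, M ≤ u → k u = 0) (hM0 : 0 ≤ M)
    {s : ℂ} (hsmall : 2 * Real.arsinh (Real.sqrt M) * |s.im| < π / 2) : eigenvalueFn k s ≠ 0 := by
  intro h0
  have := eigenvalueFn_re_pos hk hk0 hkpos hM hM0 hsmall
  rw [h0, Complex.zero_re] at this
  exact lt_irrefl _ this

/-- **`Im ĥ_k(s) ≠ 0` off the lines `Im s = 0`, `Re s = 1/2`** (small support: `2 arsinh(√M)|Im s| < π`):
the eigenvalue is then non-real, so that no square-integrable `T_k`-eigenfunction with eigenvalue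
`ĥ_k(s)` exists. [folklore] -/
theorem eigenvalueFn_im_ne_zero {M : ℝ} (hk : IsTestKernel k) (hk0 : ∀ u, 0 ≤ k u)
    (hkpos : 0 < ∫ u in Ioi 0, k u) (hM : ∀ u, M ≤ u → k u = 0) (hM0 : 0 ≤ M)
    {s : ℂ} (him : s.im ≠ 0) (hre : s.re ≠ 1 / 2) (hsmall : 2 * Real.arsinh (Real.sqrt M) * |s.im| < π) :
    (eigenvalueFn k s).im ≠ 0 := by
  unfold eigenvalueFn
  rw [specParam_eq]
  exact selbergTransform_im_ne_zero hk hk0 hkpos hM hM0 him (by intro h; apply hre; linarith) hsmall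

end Eigenvalue

/-! ## 2. Smooth non-negative test kernels of prescribed small support -/

section BumpKernel

/-- **The bump kernel of support `M`**: a smooth function `ℝ → [0, 1]`, equal to `1` on `|u| ≤ M/2` and
to `0` on `|u| ≥ M` (`M > 0`). [folklore] -/
def bumpKernel (M : ℝ) (hM : 0 < M) : ℝ → ℝ :=
  ((⟨M / 2, M, by positivity, by linarith⟩ : ContDiffBump (0 : ℝ)) : ℝ → ℝ)

variable {M : ℝ} (hM : 0 < M)

/-- `0 ≤ k_M`. [folklore] -/
theorem bumpKernel_nonneg (u : ℝ) : 0 ≤ bumpKernel M hM u := ContDiffBump.nonneg _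

/-- `k_M ≤ 1`. [folklore] -/
theorem bumpKernel_le_one (u : ℝ) : bumpKernel M hM u ≤ 1 := ContDiffBump.le_one _

/-- `k_M = 1` on `[0, M/2]` (indeed on `|u| ≤ M/2`). [folklore] -/
theorem bumpKernel_eq_one {u : ℝ} (hu : |u| ≤ M / 2) : bumpKernel M hM u = 1 := by
  unfold bumpKernel
  apply ContDiffBump.one_of_mem_closedBall
  simpa [mem_closedBall, dist_zero_right] using hu

/-- `k_M = 0` on `[M, ∞)`. [folklore] -/
theorem bumpKernel_eq_zero {u : ℝ} (hu : M ≤ u) : bumpKernel M hM u = 0 := by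
  unfold bumpKernel
  apply ContDiffBump.zero_of_le_dist
  simp only [dist_zero_right, Real.norm_eq_abs]
  exact hu.trans (le_abs_self u)

/-- `k_M` is smooth. [folklore] -/
theorem contDiff_bumpKernel (n : ℕ∞) : ContDiff ℝ n (bumpKernel M hM) := ContDiffBump.contDiff _

/-- `k_M` is continuous. [folklore] -/
theorem continuous_bumpKernel : Continuous (bumpKernel M hM) := ContDiffBump.continuous _

/-- `k_M` is a test kernel supported in `u ≤ M`. [folklore] -/
theorem isTestKernel_bumpKernel : IsTestKernel (bumpKernel M hM) where
  measurable := (continuous_bumpKernel hM).measurable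
  bounded := ⟨1, fun u => by
    rw [abs_of_nonneg (bumpKernel_nonneg hM u)]; exact bumpKernel_le_one hM u⟩
  eventually_zero := ⟨M, hM.le, fun _ hu => bumpKernel_eq_zero hM hu⟩

/-- `k_M` is Lipschitz. [folklore] -/
theorem exists_lipschitzWith_bumpKernel : ∃ L : ℝ≥0, LipschitzWith L (bumpKernel M hM) := by
  have hcs : HasCompactSupport (bumpKernel M hM) := by
    unfold bumpKernel; exact ContDiffBump.hasCompactSupport _
  exact (contDiff_bumpKernel hM 1).lipschitzWith_of_hasCompactSupport hcs one_ne_zero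

/-- `∫₀^∞ k_M ≥ M/2 > 0`. [folklore] -/
theorem integral_bumpKernel_pos : 0 < ∫ u in Ioi 0, bumpKernel M hM u := by
  have hint : IntegrableOn (bumpKernel M hM) (Ioi 0) := by
    have hcs : HasCompactSupport (bumpKernel M hM) := by
      unfold bumpKernel; exact ContDiffBump.hasCompactSupport _
    exact ((continuous_bumpKernel hM).integrable_of_hasCompactSupport hcs).integrableOn
  have h1 : ∫ u in Ioc 0 (M / 2), bumpKernel M hM u = M / 2 := by
    have e : ∫ u in Ioc 0 (M / 2), bumpKernel M hM u = ∫ u in Ioc 0 (M / 2), (1 : ℝ) := by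
      refine setIntegral_congr_fun measurableSet_Ioc fun u hu => ?_
      exact bumpKernel_eq_one hM (by rw [abs_of_pos hu.1]; exact hu.2)
    rw [e, setIntegral_const, smul_eq_mul, mul_one, Real.volume_real_Ioc_of_le (by positivity), sub_zero]
  have h2 : ∫ u in Ioc 0 (M / 2), bumpKernel M hM u ≤ ∫ u in Ioi 0, bumpKernel M hM u :=
    setIntegral_mono_set hint (Eventually.of_forall fun u => bumpKernel_nonneg hM u)
      (Eventually.of_forall Ioc_subset_Ioi_self)
  linarith

/-- The support radius `R_M = 2 arsinh √M` of `k_M` tends to `0` with `M`: for `M ≤ sinh(ρ/2)²`,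
`R_M ≤ ρ`. [folklore] -/
theorem kernelRadius_le_of_le {ρ : ℝ} (hρ : 0 ≤ ρ) {M : ℝ} (hMρ : M ≤ Real.sinh (ρ / 2) ^ 2) :
    kernelRadius M ≤ ρ := by
  unfold kernelRadius
  have h1 : Real.sqrt M ≤ Real.sinh (ρ / 2) := by
    rw [Real.sqrt_le_left (Real.sinh_nonneg_iff.mpr (by linarith))]
    exact hMρ
  have h2 : Real.arsinh (Real.sqrt M) ≤ ρ / 2 := by
    calc Real.arsinh (Real.sqrt M) ≤ Real.arsinh (Real.sinh (ρ / 2)) := Real.arsinh_le_arsinh.mpr h1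
      _ = ρ / 2 := Real.arsinh_sinh _
  linarith

/-- **The kernel for the strip of height `N`**: `k^{(N)} = k_{M_N}` with `M_N = sinh(1/(4(N+1)))²`, so
that `R_{M_N} (N + 1) ≤ 1/2 < π/2` and `Re ĥ_{k^{(N)}} > 0` on `|Im s| < N + 1`. [folklore] -/
def stripSupport (N : ℕ) : ℝ := Real.sinh (1 / (4 * ((N : ℝ) + 1))) ^ 2

/-- `M_N > 0`. [folklore] -/
theorem stripSupport_pos (N : ℕ) : 0 < stripSupport N := by
  unfold stripSupport
  exact pow_pos (Real.sinh_pos_iff.mpr (by positivity)) 2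

/-- `R_{M_N} ≤ 1/(2(N+1))`. [folklore] -/
theorem kernelRadius_stripSupport_le (N : ℕ) : kernelRadius (stripSupport N) ≤ 1 / (2 * ((N : ℝ) + 1)) := by
  refine kernelRadius_le_of_le (by positivity) ?_
  unfold stripSupport
  rw [show 1 / (2 * ((N : ℝ) + 1)) / 2 = 1 / (4 * ((N : ℝ) + 1)) by field_simp; ring]

/-- On the strip `|Im s| < N + 1` the smallness condition `R_{M_N}|Im s| < π/2` holds. [folklore] -/
theorem stripSupport_small {N : ℕ} {s : ℂ} (hs : |s.im| < (N : ℝ) + 1) :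
    2 * Real.arsinh (Real.sqrt (stripSupport N)) * |s.im| < π / 2 := by
  have h1 : 2 * Real.arsinh (Real.sqrt (stripSupport N)) ≤ 1 / (2 * ((N : ℝ) + 1)) :=
    kernelRadius_stripSupport_le N
  have hN : (0 : ℝ) < (N : ℝ) + 1 := by positivity
  have h2 : 2 * Real.arsinh (Real.sqrt (stripSupport N)) * |s.im| ≤ 1 / (2 * ((N : ℝ) + 1)) * ((N : ℝ) + 1) :=
    mul_le_mul h1 hs.le (abs_nonneg _) (by positivity)
  have h3 : 1 / (2 * ((N : ℝ) + 1)) * ((N : ℝ) + 1) = 1 / 2 := by field_simp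
  have hπ : (1 : ℝ) / 2 < π / 2 := by linarith [Real.pi_gt_three]
  linarith

/-- … and the weaker condition `R_{M_N}|Im s| < π` of `eigenvalueFn_im_ne_zero`. [folklore] -/
theorem stripSupport_small' {N : ℕ} {s : ℂ} (hs : |s.im| < (N : ℝ) + 1) :
    2 * Real.arsinh (Real.sqrt (stripSupport N)) * |s.im| < π := by
  have := stripSupport_small hs
  linarith [Real.pi_pos]

end BumpKernel

end Literature.NumberTheory.Automorphic
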